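import Summits.QuantumFields.BalabanUV.T4Continuum.Support.VariationalTaxiTowerFlux
import Mathlib.Analysis.SpecialFunctions.Trigonometric.Bounds
import Mathlib.Analysis.SpecialFunctions.Complex.Log

/-!
# T⁴ programme, spine node NE2 (U1a), lane P2 — SUPPORT: THE COHERENT TAXI TOWER (U(1)), PART 3b — THE CONSTANT-FLUX TOWER
# (`q` flux quanta through the `(μ₀, μ₁)`-plane at EVERY level): unit, scale-invariant plaquette class, COHERENT, NOT FLAT (file 2∕2)

NE2 formalisation swarm `b2b-balaban-t4-ne2-formalise-*`, leaf 04 GEN 3 (`prover-b2b-balaban-t4-ne2-formalise-leaf-04-g3-0`); register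
P2-sup item (O7) «TAXI TOWER END» (owner GO CLAIMS.log l.11188; this unit's INTENT l.11043, part (4)).  File 1∕2 `VariationalTaxiTowerFlux`
has the phases `fluxR μ₀ μ₁ N₀ u` on one torus (plaquettes `= u` in the `(μ₀, μ₁)`-plane, `‖plaq − 1‖ ≤ ‖u − 1‖`, straight coarsening
`coarseT_fluxR`, `Rtr_fluxR`).  THIS FILE:
 * §1 the FLUX UNIT `uflux q N₀ N₁ = exp(2πi·q/(N₀N₁))`: `norm_uflux` (`= 1`), `norm_uflux_sub_one_le` (`≤ 2πq/(N₀N₁)`), `uflux_pow_eq_one`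
   (`uflux^{N₀N₁} = 1` — flux quantisation), `uflux_refine_pow` (`uflux q (L N₀) (L N₁)^{L²} = uflux q N₀ N₁` — coherence of the units),
   `uflux_ne_one` (`0 < q < N₀N₁ ⇒ uflux ≠ 1`);
 * §2 **THE CONSTANT-FLUX TOWER** `fluxTower L M μ₀ μ₁ q k := fluxR μ₀ μ₁ (L^(k+1)·M μ₀) (uflux q (L^(k+1) M μ₀) (L^(k+1) M μ₁))` on
   `Tor (fine L (fine (L^k) M))` — EXACTLY the four data binders of PART 2's taxi tower END: `norm_fluxTower` (hR1), **`plaq_fluxTower_sub_one_le`**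
   (ha′ with `a′_k := 2πq/((L^(k+1)M μ₀)(L^(k+1)M μ₁))`), **`fluxTower_coherent`** (hcoh: `coarseT L (fine (L^(k+1)) M) (fluxTower (k+1)) =
   Rtr (L^k) L M (fluxTower k)` VERBATIM), **`class_fluxTower`** (hclass, EXACTLY scale-invariant: `(L^k·L)²·a′_k = 2πq/(M μ₀ · M μ₁)`), and
   **`plaq_fluxTower_ne_one`**: for `0 < q < (L^(k+1)M μ₀)(L^(k+1)M μ₁)` the `(μ₀, μ₁)` plaquettes of level `k` are NOT `1` — NOT FLAT.

HONEST FRAMING (T4-DAG p. 1).  A TOY member of the data class (OURS), elementary; nothing printed is a hypothesis; two data `def`s (`uflux`,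
`fluxTower`), no `def … : Prop`; no `sorry`; axioms standard.  It asserts nothing about Bałaban's minimisers (no B0, c5), nothing about node
NE3, and by itself no END (PART 2 consumes it); model level U(1); NE2 NOT proved; spine 0/9; rung (B)+1 finite T⁴ — NOT infinite volume, NOT
mass gap, NOT Clay.  HONEST DEPENDENCY (cell, verbatim): continuum YM on T⁴ ⇐ BetaPertH ∧ nine spine estimates (0/9 proved);
BetaPertH ⇐ (D1) ∧ (D4) ∧ CAP+tail; G-an2-4 gates asym, D1 and NE2/3/4.
-/

noncomputable section

open scoped BigOperators ComplexConjugate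
open Finset

namespace Summit.QuantumFields.BalabanUV.T4Continuum.VariationalTaxiTowerFluxTower

open Literature.MathematicalPhysics.QuantumFieldTheory.Balaban1983to89.B5Prop11Plancherel (Tor fine unitVec)
open Summit.QuantumFields.BalabanUV.T4Continuum.VariationalCovariantTower (Rtr)
open Summit.QuantumFields.BalabanUV.T4Continuum.VariationalTaxiTransport
open Summit.QuantumFields.BalabanUV.T4Continuum.VariationalTaxiCoarse
open Summit.QuantumFields.BalabanUV.T4Continuum.VariationalTaxiTowerFlux

variable {d : ℕ}

/-! ## §1 The flux unit -/

section Unit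

/-- the FLUX UNIT `exp(2πi·q/(N₀N₁))` — `q` flux quanta through an `N₀ × N₁` torus plane. [folklore] -/
def uflux (q N₀ N₁ : ℕ) : ℂ := Complex.exp (Complex.I * ((2 * Real.pi * q / (N₀ * N₁) : ℝ) : ℂ))

/-- `|uflux| = 1`. [folklore] -/
theorem norm_uflux (q N₀ N₁ : ℕ) : ‖uflux q N₀ N₁‖ = 1 := by
  rw [uflux, mul_comm]; exact Complex.norm_exp_ofReal_mul_I _

/-- `‖uflux − 1‖ ≤ 2πq/(N₀N₁)`. [folklore] -/
theorem norm_uflux_sub_one_le (q N₀ N₁ : ℕ) : ‖uflux q N₀ N₁ - 1‖ ≤ 2 * Real.pi * q / ((N₀ : ℝ) * N₁) := by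
  refine (Real.norm_exp_I_mul_ofReal_sub_one_le).trans (le_of_eq ?_)
  rw [Real.norm_eq_abs, abs_of_nonneg (by positivity)]

/-- FLUX QUANTISATION: `uflux^{N₀N₁} = 1`. [folklore] -/
theorem uflux_pow_eq_one (q : ℕ) {N₀ N₁ : ℕ} (hN : N₀ * N₁ ≠ 0) : uflux q N₀ N₁ ^ (N₀ * N₁) = 1 := by
  rw [uflux, ← Complex.exp_nat_mul]
  have h0 : (N₀ : ℂ) ≠ 0 := by exact_mod_cast (Nat.mul_ne_zero_iff.mp hN).1
  have h1 : (N₁ : ℂ) ≠ 0 := by exact_mod_cast (Nat.mul_ne_zero_iff.mp hN).2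
  have e : ((N₀ * N₁ : ℕ) : ℂ) * (Complex.I * ((2 * Real.pi * q / (N₀ * N₁) : ℝ) : ℂ)) = (q : ℂ) * (2 * Real.pi * Complex.I) := by
    push_cast
    field_simp
  rw [e]
  exact Complex.exp_nat_mul_two_pi_mul_I q

/-- COHERENCE OF THE FLUX UNITS: refining both moduli by `L` and raising to the `L²` gives the unit back. [folklore] -/
theorem uflux_refine_pow (q : ℕ) {L N₀ N₁ : ℕ} (hL : L ≠ 0) (hN : N₀ * N₁ ≠ 0) :
    uflux q (L * N₀) (L * N₁) ^ (L * L) = uflux q N₀ N₁ := by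
  rw [uflux, uflux, ← Complex.exp_nat_mul]
  congr 1
  have h0 : (N₀ : ℂ) ≠ 0 := by exact_mod_cast (Nat.mul_ne_zero_iff.mp hN).1
  have h1 : (N₁ : ℂ) ≠ 0 := by exact_mod_cast (Nat.mul_ne_zero_iff.mp hN).2
  have hL' : (L : ℂ) ≠ 0 := by exact_mod_cast hL
  push_cast
  field_simp

/-- NON-TRIVIALITY: `uflux ≠ 1` for `0 < q < N₀N₁`. [folklore] -/
theorem uflux_ne_one {q N₀ N₁ : ℕ} (hq : 0 < q) (hqN : q < N₀ * N₁) : uflux q N₀ N₁ ≠ 1 := by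
  intro h
  rw [uflux, Complex.exp_eq_one_iff] at h
  obtain ⟨n, hn⟩ := h
  have hN : (0 : ℝ) < (N₀ : ℝ) * N₁ := by
    have : 0 < N₀ * N₁ := lt_of_le_of_lt (Nat.zero_le _) hqN
    exact_mod_cast this
  have hθ : (2 * Real.pi * q / (N₀ * N₁) : ℝ) = n * (2 * Real.pi) := by
    have e : Complex.I * ((2 * Real.pi * q / (N₀ * N₁) : ℝ) : ℂ) = Complex.I * ((n * (2 * Real.pi) : ℝ) : ℂ) := by
      rw [hn]; push_cast; ring
    exact_mod_cast mul_left_cancel₀ Complex.I_ne_zero e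
  have h1 : (0 : ℝ) < n := by
    have : (0 : ℝ) < 2 * Real.pi * q / (N₀ * N₁) := by positivity
    rw [hθ] at this
    nlinarith [Real.pi_pos]
  have h2 : (n : ℝ) < 1 := by
    have hlt : (2 * Real.pi * q / (N₀ * N₁) : ℝ) < 2 * Real.pi := by
      rw [div_lt_iff₀ hN]
      have : (q : ℝ) < (N₀ : ℝ) * N₁ := by exact_mod_cast hqN
      nlinarith [Real.pi_pos]
    rw [hθ] at hlt
    nlinarith [Real.pi_pos]
  have h1' : (0 : ℤ) < n := by exact_mod_cast h1
  have h2' : n < (1 : ℤ) := by exact_mod_cast h2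
  omega

end Unit

/-! ## §2 The constant-flux tower -/

section Tower

variable (L : ℕ) [NeZero L] (M : Fin d → ℕ) [hM : ∀ ν, NeZero (M ν)] (μ₀ μ₁ : Fin d) (q : ℕ)

/-- **THE CONSTANT-FLUX TOWER**: at level `k` the one-step phases on `Tor (fine L (fine (L^k) M))` with `μ₀`-modulus `L^(k+1)·M μ₀` and
flux unit `exp(2πi·q/((L^(k+1)M μ₀)(L^(k+1)M μ₁)))` — the SAME `q` flux quanta through the `(μ₀, μ₁)`-plane at every level. [folklore] -/
def fluxTower (k : ℕ) : Tor (fine L (fine (L ^ k) M)) → Fin d → ℂ :=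
  fluxR μ₀ μ₁ (L ^ (k + 1) * M μ₀) (uflux q (L ^ (k + 1) * M μ₀) (L ^ (k + 1) * M μ₁))

omit [NeZero L] hM in
/-- the moduli of the level-`k` one-step torus. [folklore] -/
theorem fine_lev (k : ℕ) (ν : Fin d) : fine L (fine (L ^ k) M) ν = L ^ (k + 1) * M ν := by
  show L * (L ^ k * M ν) = _
  rw [pow_succ]; ring

omit [NeZero L] hM in
/-- PART 2's binder `hR1`: unit phases. [folklore] -/
theorem norm_fluxTower (k : ℕ) (x : Tor (fine L (fine (L ^ k) M))) (μ : Fin d) : ‖fluxTower L M μ₀ μ₁ q k x μ‖ = 1 :=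
  norm_fluxR μ₀ μ₁ _ _ (norm_uflux q _ _) x μ

/-- the product of the two relevant moduli is non-zero. [folklore] -/
theorem moduli_ne_zero (k : ℕ) : L ^ (k + 1) * M μ₀ * (L ^ (k + 1) * M μ₁) ≠ 0 := by
  have h0 := NeZero.ne (M μ₀); have h1 := NeZero.ne (M μ₁); have hL := NeZero.ne L
  positivity

/-- PART 2's binder `ha′`: **THE PLAQUETTE DEFECT** `‖plaq − 1‖ ≤ a′_k := 2πq/((L^(k+1)M μ₀)(L^(k+1)M μ₁))`. [folklore] -/
theorem plaq_fluxTower_sub_one_le (hL : 2 ≤ L) (hne : μ₀ ≠ μ₁) (k : ℕ) (x : Tor (fine L (fine (L ^ k) M))) (κ ν : Fin d) :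
    ‖plaq L (fine (L ^ k) M) (fluxTower L M μ₀ μ₁ q k) x κ ν - 1‖
      ≤ 2 * Real.pi * q / ((((L ^ (k + 1) * M μ₀ : ℕ)) : ℝ) * (((L ^ (k + 1) * M μ₁ : ℕ)) : ℝ)) := by
  have hK : uflux q (L ^ (k + 1) * M μ₀) (L ^ (k + 1) * M μ₁) ^ (fine L (fine (L ^ k) M) μ₀ * fine L (fine (L ^ k) M) μ₁) = 1 := by
    rw [fine_lev, fine_lev]; exact uflux_pow_eq_one q (moduli_ne_zero L M μ₀ μ₁ k)
  have h := norm_plaq_fluxR_sub_one_le L (fine (L ^ k) M) μ₀ μ₁ _ hL hne (norm_uflux q _ _) hK x κ ν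
  rw [fine_lev] at h
  exact h.trans (norm_uflux_sub_one_le q _ _)

/-- PART 2's binder `hcoh`: **THE CONSTANT-FLUX TOWER IS COHERENT** — each level's straight `L`-bond coarsening is the previous level.
[folklore] -/
theorem fluxTower_coherent (hne : μ₀ ≠ μ₁) (k : ℕ) :
    coarseT L (fine (L ^ (k + 1)) M) (fluxTower L M μ₀ μ₁ q (k + 1)) = Rtr (L ^ k) L M (fluxTower L M μ₀ μ₁ q k) := by
  have e0 : L ^ (k + 1 + 1) * M μ₀ = L * (L ^ (k + 1) * M μ₀) := by rw [pow_succ]; ring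
  have e1 : L ^ (k + 1 + 1) * M μ₁ = L * (L ^ (k + 1) * M μ₁) := by rw [pow_succ]; ring
  rw [fluxTower, fluxTower, Rtr_fluxR, e0, e1, coarseT_fluxR L (fine (L ^ (k + 1)) M) μ₀ μ₁ hne,
    uflux_refine_pow q (NeZero.ne L) (moduli_ne_zero L M μ₀ μ₁ k)]
  rfl

omit [NeZero L] hM in
/-- PART 2's binder `hclass` — EXACTLY SCALE-INVARIANT: `(L^k·L)²·a′_k = 2πq/(M μ₀ · M μ₁)`. [folklore] -/
theorem class_fluxTower (hL : L ≠ 0) (k : ℕ) :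
    ((((L ^ k : ℕ)) : ℝ) * L) ^ 2 * (2 * Real.pi * q / ((((L ^ (k + 1) * M μ₀ : ℕ)) : ℝ) * (((L ^ (k + 1) * M μ₁ : ℕ)) : ℝ)))
      = 2 * Real.pi * q / ((M μ₀ : ℝ) * M μ₁) := by
  have hL' : (L : ℝ) ≠ 0 := by exact_mod_cast hL
  push_cast
  by_cases h0 : (M μ₀ : ℝ) = 0
  · simp [h0]
  by_cases h1 : (M μ₁ : ℝ) = 0
  · simp [h1]
  field_simp
  ring

/-- **NOT FLAT**: for `0 < q < (L^(k+1)M μ₀)(L^(k+1)M μ₁)` every `(μ₀, μ₁)` plaquette of level `k` equals the flux unit `≠ 1`. [folklore] -/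
theorem plaq_fluxTower_ne_one (hL : 2 ≤ L) (hne : μ₀ ≠ μ₁) (k : ℕ) (hq : 0 < q)
    (hqN : q < L ^ (k + 1) * M μ₀ * (L ^ (k + 1) * M μ₁)) (x : Tor (fine L (fine (L ^ k) M))) :
    plaq L (fine (L ^ k) M) (fluxTower L M μ₀ μ₁ q k) x μ₀ μ₁ ≠ 1 := by
  have hK : uflux q (L ^ (k + 1) * M μ₀) (L ^ (k + 1) * M μ₁) ^ (fine L (fine (L ^ k) M) μ₀ * fine L (fine (L ^ k) M) μ₁) = 1 := by
    rw [fine_lev, fine_lev]; exact uflux_pow_eq_one q (moduli_ne_zero L M μ₀ μ₁ k)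
  have h := plaq_fluxR_main L (fine (L ^ k) M) μ₀ μ₁ _ hL hne (norm_uflux q _ _) hK x
  rw [fine_lev] at h
  rw [fluxTower, h]
  exact uflux_ne_one hq hqN

end Tower



end Summit.QuantumFields.BalabanUV.T4Continuum.VariationalTaxiTowerFluxTower

end
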